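import Mathlib
import HarnessLib
import HarnessLib.Audit
import Summits.AtomisticToContinuum.Statement
import Literature.MathematicalPhysics.QuantumManyBody.PeriodicBoseGas
import Literature.MathematicalPhysics.QuantumManyBody.PeriodicBoseGasJastrow
import Literature.MathematicalPhysics.QuantumManyBody.RelativeFisherInformation
import HarnessLib.Audit.Status.Attr

/-!
Route: BECFisherTransfer

DORMANT since 2026-08-26T03:37:09Z (reconciler: no traction for 8.3 d (last activity item-evidence-added at 2026-08-17T19:20:54Z); parked, not closed — `ledger route dormant route-AtomisticToContinuum-BECFisherTransfer --off` to reactiv) — unstaffed, not closed; items shared with open routes are served there. `ledger route dormant <id> --off` reactivates.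

# Route BECFisherTransfer — energy excess = ¼ relative Fisher information — transfer coherence from
the LSSY trial state to the ground state up to (excess)^(-1/2), then propagate

It suffices to show X = X_loc ∧ X_prop on the thermodynamic TORUS of side L = (N/ρ)^(1/3), plus the
shared boundary transfer
(card relative-fisher-landscape-transfer; conforming re-filing of route BECRelativeFisher, retired
`not-a-thesis` 2026-08-15 for want
of a deciding theorem). Write G_Ψ(i,r) := Re ∫_(cell^N) conj Ψ(X with x_i ↦ x_i + r)·Ψ(X) dX for the
one-particle displacement coherence
of a periodic state (for Ψ ≥ 0 it is the Bhattacharyya affinity of |Ψ|² and its image under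
teleporting particle i by r; n₀/N = avg_r G).
X_loc = HealingScaleCoherence: for some σ > 0 every δ_N-near-minimiser of the periodic energy has G
≥ ¾ for all |r| ≤ a(ρa³)^(-1/2-σ) —
coherence parametrically BEYOND the healing length (ρa)^(-1/2), from energy: the identity
⟨Φ,(H−E₀)Φ⟩ = ∫|∇(Φ/Ψ₀)|²Ψ₀² = ¼ I(P_Φ‖P_Ψ₀)
(energy excess of a positive trial state = relative Fisher information of |Φ|² w.r.t. |Ψ₀|²)
certifies coherence exactly up to
(excess per particle)^(-1/2). X_prop = CoherencePropagation: for every σ > 0 such near-field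
coherence forces n₀ ≥ N/2 (the infrared half;
quantitative ¾ ⇒ ½, not ∃c). X_loc ∧ X_prop give PeriodicBEC with c = ½ (target, shared
stmt-8997/0826); BoundaryTransferWeak (shared
stmt-0827) turns it into the Dirichlet conjunct.
Lean: `HealingScaleCoherence ∧ CoherencePropagation ∧ BoundaryTransferWeak`

## Assembly
Pure logic, PROVED sorry-free (glue.lean / Sketch.lean, axioms propext · Classical.choice ·
Quot.sound): `theorem closes (hA :
HealingScaleCoherence) (hP : CoherencePropagation) (hT : BoundaryTransferWeak) :
_root_.BoseEinsteinCondensation` — fix v; hA gives σ and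
ρ₂ with an eventual-in-N slack δ₂; hP at that σ gives ρ₁ and an eventual δ₁; for ρ < min ρ₁ ρ₂ and δ
:= min δ₁ δ₂ every δ-near-minimiser
satisfies the ¾-coherence hypothesis hence has condensateOccupation ≥ N/2, which is the PeriodicBEC
clause for v with c = ½; hT v turns it
into ∃ρ₀ ∀ρ<ρ₀ HasGroundStateBEC v ρ, the body of the Statement decl `BoseEinsteinCondensation`
(root abbrev). PeriodicRigidity and the three
supports are inputs to the PROOFS of ranks 2–3 (positivity reaches near-minimisers through them),
not antecedents of `closes`;
`example : Assembly := closes` checks the Assembly item is literally its type.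

Rationale: WHY THIS LINE. The ground-state representation ⟨Φ,(H−E₀)Φ⟩ = ∫|∇(Φ/Ψ₀)|²Ψ₀²
(LiebSeiringerSolovejYngvason2005 (6.26)–(6.28), Ch. 7 (7.5); Dirichlet form of
the ground-state-transformed generator, AlbeverioHoeghkrohnStreit1977) says that the energy excess
per particle e of a POSITIVE trial state
equals ¼ of the relative Fisher information per particle of |Φ|² w.r.t. |Ψ₀|² (OttoVillani2000,
RezakhanlouVillani2008 §1.3), i.e. the
mean-square mismatch between its conditional one-body drift and the true one — the score-matching
way of comparing two laws without the
normaliser; since for Ψ₀ > 0 the coherence G(r) is an affinity between P₀ and its one-particle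
translate, a line integral of the drift
mismatch transfers the EXPLICIT coherence of the trial state to Ψ₀ up to |r| ≲ e^(-1/2), using
exactly the two exits (eigen-equation beyond
the value E₀; positivity) that the PROVED obstruction
Literature.Barriers.AtomisticToContinuum.KineticGapLengthScalesNarrow leaves open, with
no box hierarchy and no spectral gap. With the tree's PROVED two-sided bounds
(LSSY2005_lowerBound_periodic_holds,
LSSY2005_upperBound_periodic_holds via the positive Jastrow state of LSSY2005_jastrowBound_holds /
LSSY2005_dysonProfile_holds) e ≲ ρaY^(1/17)
and the scale is a(ρa³)^(-1/2-σ), σ < 1/34 (HealingScaleCoherence, which ALSO has an in-class proof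
by LSSY2005_lemma52_periodic_holds +
LSSY2005_lemma41_periodic_holds, LSSY2005 pp. 37, 58 — so rank 3, not 2); with LHY two-sided bounds
(FournaisSolovej2020, YauYin2009,
BastiCenatiempoSchlein2021; not vendored, deliberately not an item) it reaches Junge2026's
a(ρa³)^(-3/4) GAP-FREE, and the Galilei-boost
witnesses of KineticGapLengthScalesNarrow show energy information stops exactly there (the card's
(B), a theorem of the tree).
Imported: relative entropy / Fisher-information calculus of diffusion generators (kinetic theory;
for the GP limit the dictionary
'ground state = interacting Nelson–Carlen diffusions, energy localisation = L²-closeness of drifts'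
is printed, MoratoUgolini2011,
arXiv:1512.04729 Thm 3.5, there as a CONSEQUENCE of LSY's BEC theorem) and the affinity reading of
ODLRO for positive states. What it does that siblings do not: BECParentAnchor bounds the TRUE-law
Fisher information w.r.t. a Jastrow PARENT
Hamiltonian (ParentEnergyProximity, no rate) and bets on corrector flatness; BECRieszShadow /
BECLiebAntibunching posit O(1) Palm–KL bounds
on the TRUE landscape; this route splits PeriodicBEC along the LENGTH axis into an energy-driven
half stated at a ρ-dependent, N-uniform
scale resting on PROVED cone facts (X_loc) plus two provable mechanism lemmas
(GroundStateRepresentation, TrialDriftFisherBound: the LSSY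
trial state's conditional drift is L²-close to the true one), and the genuinely infrared half
(X_prop), for which the card's programme
is the foreseen layer-2 attack (mean deviation of log(Ψ₀/Φ) across the whole cell; f = Ψ₀/Φ is the
principal eigenfunction of the Witten
Laplacian of the trial measure plus the explicit residual, whose one-particle spectrum is the phonon
branch). Negatives index (6 entries,
1 BEC: BECSwapAffinity.SwapJensen, a sign-unguarded constant) shares no statement with this route;
every constant here is explicit (¾, ½).

RANKED CRUXES. #0 PeriodicBec (target) — PeriodicBEC — constant-mode BEC for δ-near-minimisers of
the periodic N-body energy on the torus of side (N/ρ)^(1/3), every repulsive finite-range v, all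
small ρ; verbatim the shared item stmt-AtomisticToContinuum-8997 (= 0826; BECParentAnchor,
BECSubharmonicContinuation). Here obtained with c = ½ from HealingScaleCoherence ∧
CoherencePropagation by pure logic (Sketch.lean `periodicBec_of`). (why it might fail: the textbook
open problem (LiebSeiringerSolovejYngvason2005 §1.2, Ch. 5 p. 42): no spectral gap at L =
(N/ρ)^(1/3); for this route it fails iff CoherencePropagation fails.)
[LiebSeiringerSolovejYngvason2005, Fournais2020, Junge2026, ChongLiangNam2026]
#2 CoherencePropagation (crux) — X_prop (card crux (C) in robust, quantitative dress). For every
repulsive finite-range v and every σ > 0 there is ρ₀ > 0 such that for 0 < ρ < ρ₀, for all large N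
there is δ > 0 with: every periodic trial state Ψ on the torus of side L = (N/ρ)^(1/3) with
periodicEnergy ≤ E₀^per + δ AND displacement coherence G_Ψ(i,r) ≥ ¾ for all particles i and all |r|
≤ a(ρa³)^(-1/2-σ) (a = scattering length) has condensateOccupation ≥ N/2 — near-field coherence at
any scale parametrically beyond the healing length propagates to the whole torus with at most ¼
further loss, UNIFORMLY in N (n₀/N = avg_r G; the ½ is not implied by any ∃c statement). Informal
mechanism: beyond e^(-1/2) the mismatch f = Ψ₀/Φ_trial must not be parked in the infrared window |k|
< e^(1/2), i.e. log f(·,X̂) has O(1) mean deviation across the whole cell (layer 2). [deps: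
HealingScaleCoherence] [difficulty: open-problem] (why it might fail: BEC-strength: a 3-D T=0
quasi-condensate (G ≥ ¾ out to a(ρa³)^(-1/2-σ), but occupation ≥ N/2 parked at momenta 0<|k|≲√e) is
excluded by no theorem; energy cannot see it (boosts cost only N/L², KineticGapLengthScalesNarrow);
it happens in d=1 (PitaevskiiStringari1991).) [LiebSeiringerSolovejYngvason2005,
PitaevskiiStringari1991, ReattoChester1967, Junge2026, Fournais2020,
Literature.Barriers.AtomisticToContinuum.KineticGapLengthScalesNarrow]
#3 HealingScaleCoherence (crux) — X_loc (card consequence (A) at the precision of PROVED energy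
facts). For every repulsive finite-range v there are σ > 0 and ρ₀ > 0 such that for 0 < ρ < ρ₀, all
large N, some δ > 0 and every δ-near-minimiser Ψ of the periodic energy on the torus of side
(N/ρ)^(1/3): G_Ψ(i,r) ≥ ¾ for every particle i and every |r| ≤ a(ρa³)^(-1/2-σ) — local coherence of
the THERMODYNAMIC object parametrically beyond the healing length. Two proofs foreseen: (i) the
card's: GroundStateRepresentation + TrialDriftFisherBound (e ≲ ρaY^(1/17)) + a Palm-transport step
along r (Cauchy–Schwarz in the trial bridge measure) + PeriodicRigidity to reach near-minimisers;
(ii) in-class: energy localisation LSSY2005_lemma52_periodic_holds + generalized Poincaré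
LSSY2005_lemma41_periodic_holds on sub-cells of side ℓ = aY^(-1/2-σ) applied to every state in the
window directly (no rigidity, no positivity), which works iff ρaℓ²Y^(1/17) ≪ 1, given an o(1) bound
on the mass of over-crowded ℓ-cubes (excluded volume ≪ ℓ³) from superadditivity / the cell method
(LSSY2005_superadditivity_holds, LSSY2005_cellDecomposition_holds). [difficulty: L] (why it might
fail: Needs E₀^per < ⊤ and both LSSY bounds at L=(N/ρ)^(1/3) for EVERY admissible v incl. hard
cores/hollow shells (ρ₀(v) must beat jamming); σ < 1/34; and beyond ξ a no-clustering bound (o(1)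
mass in ℓ-cubes holding ≫ ρℓ³ particles, for near-minimisers) from the cell method — unprinted at
this scale.) [LiebSeiringerSolovejYngvason2005, LiebSeiringer2002, Fournais2020, Junge2026,
OttoVillani2000, AlbeverioHoeghkrohnStreit1977]
#4 BoundaryTransferWeak (crux) — verbatim the shared item stmt-AtomisticToContinuum-0827 (a dozen
open routes): for each repulsive finite-range v, the PeriodicBEC clause for v implies
HasGroundStateBEC v ρ for all small ρ (Dirichlet ground state, λ_max(γ) ≥ cN via condensateNumber;
mode-free criterion λ_max ≥ tr γ²/N = N·swapPurity is proved in tree,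
succ_mul_swapPurity_le_maxOccupation). Not glue: near-minimiser slacks are O(δ) while
Dirichlet/periodic energies differ by a wall term ≫ N/L²; expected route: Neumann bracketing of
interior sub-boxes + the mode-free step. If it dies, both cruxes have boundary-condition-free
Dirichlet twins (the identity is BC-free; G with zero-extension), see Kill criteria. [difficulty: L]
(why it might fail: PeriodicBEC(v) constrains only δ-near-minimisers of the PERIODIC energy (δ after
N): the Dirichlet GS lies a wall energy ≫ δ above E₀^per, interior restrictions are neither periodic
nor sharp-N, so the hypothesis never fires; only the ENERGY transfer is printed (LSSY Ch. 2 after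
(2.8)).) [LiebSeiringerSolovejYngvason2005, ReedSimonIV1978, Junge2026, PenroseOnsager1956]
#5 PeriodicRigidity (crux) — verbatim the shared item stmt-AtomisticToContinuum-9467
(BECLiebAntibunching/BECRieszShadow; η-first form): for every admissible v, ρ < ρ₀(v), every η > 0,
eventually in N, there is δ > 0 such that any two δ-near-minimisers Ψ, Φ of the periodic energy (L =
(N/ρ)^(1/3)) satisfy ∫_(cell^N)|Ψ − cΦ|² ≤ η for some unit complex c (E₀^per < ∞, compact resolvent,
unique positive ground state and a spectral gap at fixed N; hard cores via low-density connectivity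
of the torus hard-sphere configuration space). It is how the positivity mechanism (the identity
needs the exact Ψ₀ > 0) reaches the near-minimisers that ranks 2–3 quantify over; proof (ii) of rank
3 does not need it. [difficulty: M] (why it might fail: Bounded v: known (RS-IV XIII.47 + compact
resolvent ⇒ simple GS + gap at fixed N). ⊤-valued v (hard cores, hollow shells ⊤·1_[r₁,r₂])
disconnect the finite-energy configuration space, XIII.48(b) allows degeneracy: the dilute component
must be uniquely minimal and connected for all N; unprinted.) [ReedSimonIV1978,
BaryshnikovBubenikKahle2013, LiebSeiringerSolovejYngvason2005, Fournais2020]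
#9 GroundStateRepresentation (support) — the namesake identity, periodic form, over the landed
definition relativeFisherInformation
(Literature/MathematicalPhysics/QuantumManyBody/RelativeFisherInformation.lean): for any v, N, L, an
exact real positive C¹ minimiser Ψ₀ of the periodic energy and any real periodic trial state Φ,
periodicEnergy v Φ = E₀^per + ¼ I_(cell^N)(P_Φ‖P_Ψ₀) = E₀^per + ∫_(cell^N) |∇(Φ/Ψ₀)|² Ψ₀². Proof
without integration by parts: first variation of the constrained minimum in the symmetric C¹
direction (Φ/Ψ₀)²Ψ₀ (V ∈ L¹(cell^N) because Ψ₀ ≥ min Ψ₀ > 0 on the compact torus and E(Ψ₀) < ⊤),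
then the Jacobi identity |∇(hΨ₀)|² = |∇h|²Ψ₀² + ∇Ψ₀·∇(h²Ψ₀); E₀^per = ⊤ and L ≤ 0 are trivially
covered (⊤ + x = ⊤; no states). Vacuous for hard cores (no positive C¹ minimiser), as intended.
[difficulty: provable-now] [LiebSeiringerSolovejYngvason2005, AlbeverioHoeghkrohnStreit1977,
RezakhanlouVillani2008]
#9 TrialDriftFisherBound (support) — the mechanism's quantitative input, from PROVED cone facts
only: for every admissible v there are ρ₀, C such that for ρ < ρ₀, eventually in N, for every exact
real positive periodic minimiser Ψ₀ there is a normalised periodic trial state Φ of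
Bijl–Dyson–Jastrow form Φ = c·Π_(i<j) φ^per(x_i − x_j) (IsPairProfile b φ, jastrow of
PeriodicBoseGasJastrow.lean) with relative Fisher information I_(cell^N)(P_Φ‖P_Ψ₀) ≤
C·ρa·Y^(1/17)·N, Y = 4πρa³/3, a = scattering length — i.e. the conditional one-body drift of the
LSSY trial state is within O((ρaY^(1/17))^(1/2)) of the true drift in L²(P_Φ), per particle. Proof:
GroundStateRepresentation (I = 4(E(Φ) − E₀^per)) + the Dyson profile at b = ρ^(-1/3)
(LSSY2005_dysonProfile_holds, LSSY2005_jastrowBound_holds: E(Φ)/N ≤ 4πρa(1 + C(Y^(1/3) + Y^(1/17))))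
+ LSSY2005_lowerBound_periodic_holds (E₀^per/N ≥ 4πρa(1 − CY^(1/17))); a ≤ R₀ < ⊤ by
scatteringLength_le_range; a = 0 ⇒ v = 0 a.e. (LSSY2005_zeroScatteringLength_holds), Ψ₀ = const, φ ≡
1. [difficulty: M] [LiebSeiringerSolovejYngvason2005, Dyson1957, OttoVillani2000]
#9 PeriodicOccupationStability (support) — verbatim the shared support
stmt-AtomisticToContinuum-9164: for periodic trial states Ψ, Φ of N bosons and |c| = 1,
condensateOccupation(Ψ)^(1/2) ≤ condensateOccupation(Φ)^(1/2) + N^(1/2)(∫_(cell^N)|Ψ − cΦ|²)^(1/2)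
(Minkowski in L²(cell^(N−1)) on F_Ψ(Y) = ⟨φ₀, Ψ(·,Y)1_cell⟩); the companion of PeriodicRigidity in
every positivity-to-near-minimiser step. [difficulty: provable-now]
[LiebSeiringerSolovejYngvason2005, Fournais2020]

TWO-LAYER PLAN. CoherencePropagation ⇐ MismatchMeanDeviation → TransferGlue → CoherencePropagation
(k = 2): for BOUNDED v, with Ψ₀ > 0 the translation-invariant
periodic ground state (shared support PositiveGroundState stmt-10242) and Φ the LSSY Jastrow state
of TrialDriftFisherBound, f := Ψ₀/Φ:
MismatchMeanDeviation = E_(X∼|Ψ₀|²)[ log f(x₁,X̂) − ⨍_(y∈cell) log f(y,X̂) dy ] ≤ C uniformly in N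
(the card's IR-regularity: Σ_(k≠0)|δb̂(k)|²/k² is
literally the cell-variance of log f(·,X̂); its first moment at the Palm point is what enters) —
typed over jastrow, cellN, Real.log, ⨍, no
new notion; TransferGlue (provable): n₀(Ψ₀)/N = avg_r G(r) ≥ exp(−½ avg_r KL(P₀‖τ_r P₀)) (Jensen
twice), avg_r KL = 2ρ‖log φ‖₁-term (explicit,
Campbell averaging, no density bound) + 2·MismatchMeanDeviation, then PeriodicRigidity +
PeriodicOccupationStability for near-minimisers; the
⊤-valued class (hard cores) by a third child HardCoreTruncation (positive C¹ near-minimisers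
approximating Ψ₀, truncated Jensen) if needed (k ≤ 3).
HealingScaleCoherence ⇐ either FisherTransport (I(P_Φ‖P₀) ≤ 4eN ⇒ E_bridge|f∘τ_r − f|² ≤ C|r|²e via
a local-crowding moment under the
Fisher-weighted measure) → rank 3, or CellLocalisation (Lemma 5.2 + Lemma 4.1 on ℓ-cells, randomly
shifted partitions) → rank 3; one active
decomposition at a time, the other stays a direct proof. Nothing here is filed now.

KILL CRITERIA. ¬CoherencePropagation for some admissible v at arbitrarily small ρ (near-field
coherence WITHOUT n₀ ≥ N/2, i.e. a 3-D T = 0 quasi-condensate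
or depletion > ½ in the dilute limit) closes the route `refuted:CoherencePropagation` and,
physically, PeriodicBEC with it; if the witness only
beats the constant ½ (depletion between ½ and 1 − c), restate with the ∃c conclusion (misstated
class). ¬HealingScaleCoherence through an
E₀^per = ⊤ / jamming artefact for an exotic ⊤-valued v ⇒ restate with an explicit finiteness guard
or a smaller ρ₀ (misstated); genuinely
(coherence lost below aY^(-1/2-σ) for every σ) would contradict the localisation technology — close.
¬BoundaryTransferWeak kills the Dirichlet
end only: pivot to Dirichlet twins of ranks 2–3 (G with zero-extension, conclusion maxOccupation ≥
N/2, then le_condensateNumber; the identity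
is boundary-condition free). ¬PeriodicRigidity (hard-core degeneracy) forces the 'SOME positive
near-minimiser' typing of the sibling routes in
the layer-2 children only. PeriodicBEC (stmt-8997) proved elsewhere moots ranks 2–3;
TeleportEntropyBound (stmt-9158) proved gives rank 2 for
bounded v. A proof that for EVERY positive LSSY-accurate Jastrow family the mean deviation of
log(Ψ₀/Φ) grows like log L kills the card's
layer-2 programme (not the typed cruxes).

NOT DECOMPOSED YET. The Palm-transport / local-crowding lemma and the cell-localisation bookkeeping
behind rank 3 (layer-2 alternatives above); the typed
MismatchMeanDeviation child of rank 2 and its spectral form (f as principal eigenfunction of the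
Witten Laplacian −L_Φ + e_loc of the trial
measure; one-phonon Ward cancellation of the Jastrow residual, two-phonon sourcing IR-convergent in
d = 3 with vertex ≍ √(k₁k₂k₃)); hard-core
bookkeeping (truncated Jensen, E₀^per < ∞ at small ρ); the LHY-precision upgrade of rank 3 to the
scale a(ρa³)^(-3/4) (needs FournaisSolovej2020 /
YauYin2009 / BastiCenatiempoSchlein2021 as named facts — deliberately not items, so the cone stays
proved); the Dirichlet twins; positive temperature.

CHEAPEST FALSIFIER. Free gas v = 0: a = 0, the coherence hypotheses are vacuous (r = 0 only, G(i,0)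
= 1), CoherencePropagation reduces to free periodic BEC with δ
below the gap (2π/L)² (n₀ ≥ N(1 − δL²/4π²) ≥ N/2 for δ = 2π²/L²) — true and provable;
TrialDriftFisherBound holds with φ ≡ 1. Cheapest real test,
run by hand against the exact quantifier order: the Galilei-boost / phase-modulation family of
KineticGapLengthScalesNarrow
(energyWindow_fraction_le, proved): a boost costs 4π²N/L² ≫ δ_N because δ is chosen AFTER N, so no
δ-near-minimiser is a boost — both cruxes
pass; the amplitude modulations Π(1 + t cos(2πx_j1/L))Φ deplete t²/2 at cost t²·2π²N/L² ≫ δ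
likewise. Constants: Bogoliubov depletion
(8/(3√π))√(ρa³) ≈ 1.505√(ρa³) must stay below ¼ (G ≥ ¾) resp. ½: ρa³ < 0.027, absorbed in ρ₀(v).
Lookup that downgrades rank 3 to 'known':
LSSY2005 p. 35/42 ('BEC on a length scale ρ^(-1/3)Y^(-1/17)', informal, GP-box method) — conceded:
rank 3 is in-class, ranked 3 not 2.

NUMBERS. Healing length ξ = (8πρa)^(-1/2) = a(ρa³)^(-1/2)/√(8π). Energy precision available as
THEOREMS of the tree: relative Y^(1/17) below (LSSY2005
Thm 2.4 / Lemma 5.2, Y = 4πρa³/3, N ≥ Y^(-1/17), L/a > C'Y^(-6/17)) and a/b + (ab)²ρ² ~ Y^(1/3)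
above (Thm 2.2, Jastrow at b = ρ^(-1/3)), so
e ≲ ρaY^(1/17) and the transfer / localisation scale is e^(-1/2) ≈ ξY^(-1/34) ⇒ any σ < 1/34 in rank
3 (plus the o(1) over-crowding
mass bound: typical excluded volume per ℓ-cube is ρR³ℓ³ = (3/4π)Y^(2/17)ℓ³ ≪ ℓ³, R = aY^(-5/17)).
LHY precision (ρa³)^(1/2+η), η = 1/32 at T = 0 (Junge2026 Remark 5) ⇒ scale a(ρa³)^(-3/4-η/2)
(Fournais2020
remark after Thm 1.2; Junge2026 Cor. 6: R ≥ a(ρa³)^(-1/2-η), κ slightly above 2/5 against κ = 2/3).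
Fournais2020 Thm 1.2 (PROVED in tree,
Fournais2020_condensation_holds): BEC on tori of side C(ρa³)^(-δ)(ρa)^(-1/2). Expected truth: G(r) ↘
n₀/N = 1 − 1.505√(ρa³) + …, flat beyond ξ
(n_k ≍ 1/k). Thresholds ¾ (near field) and ½ (far field). Items at open: 9 (target, assembly, 4
cruxes of which 3 shared, 3 supports of
which 1 shared).

DEFINITION REQUESTS. None new: relativeFisherInformation (defn-relativeFisherInformation) has landed
in
Literature/MathematicalPhysics/QuantumManyBody/RelativeFisherInformation.lean and is used by
GroundStateRepresentation / TrialDriftFisherBound;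
jastrow / IsPairProfile / pairFactor are in PeriodicBoseGasJastrow.lean /
PeriodicBoseGasUpperBound.lean. The layer-2 child MismatchMeanDeviation
is typeable over existing vocabulary (Real.log, ⨍, cellN); its spectral form would want the
ground-state-transformed generator (Witten
Laplacian) of a positive periodic trial state — to be requested only when that split is filed. Cite
facts wanted later (not load-bearing):
LHY lower bound (FournaisSolovej2020 Thm 1.1 / FournaisSolovej2022) and LHY upper bound (YauYin2009;
BastiCenatiempoSchlein2021 Thm 1.1).

Novelty: Searches (2026-08-15, this seat): `lit frontier AtomisticToContinuum --since 2021` (30 rows;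
Bose-gas descendants arXiv:2510.20493,
arXiv:2603.20776, arXiv:2605.06844, arXiv:2602.16566 — kinetic/Neumann localisation and Fock-space
trial states, no positivity transfer);
`lit bridges AtomisticToContinuum --cross any` (30 rows, no Bose-gas bridge); `lit search --hybrid
--no-graph "ground state representation
relative Fisher information Bose gas condensation trial state"` (10 held books: LSSY2005 pp.
35/166/171, Pethick–Smith, Benedikter–Porta–Schlein,
Zhai — energy or textbook BEC only); `lit galaxy search "relative Fisher information" --star all`
(19 rows: Rezakhanlou–Villani LNM 1916,
Blower, Carlen–Madiman, Matthes' entropy-method notes, score-based-diffusion / Langevin-sampling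
papers — kinetic theory, OT, sampling; no
quantum many-body use); `lit galaxy search --star pdf --mode bm25 "trial function close in energy to
the ground state condensate"` (10 rows,
cold-atom physics, irrelevant); `lit search --source s2 "Bose-Einstein condensation interacting
ground state thermodynamic limit Jastrow
relative entropy"` (14 rows: the Morato–Ugolini / Albeverio–De Vecchi–Ugolini stochastic-mechanics
papers below, Bolte–Kerner graphs;
OpenAlex 429, zbMATH 0, arXiv 0); LSSY2005 read pp. 37 (Lemma 5.2 (5.5)–(5.6)) and 58 ((7.5) f_X =
Ψ₀/φ_GP, 'nearly constant ⇒ BEC');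
searchd cascade (OpenAlex/S2/arXiv/zbMATH/Crossref) rc 75 three times this session — recorded,
covered by the card's five  [refs: 10.1007/s00023-011-0116-1, 10.1007/978-3-0348-0545-2_9, 10.1006/jfan.1999.3557, 2510.20493, 2603.20776, 2605.06844, 2602.16566, 1512.04729, 1903.07128, 2011.00309, doi:10.1007/s00023-011-0116-1, doi:10.1007/978-3-0348-0545-2_9, doi:10.1006/jfan.1999.3557, LSSY2005, MoratoUgolini2011, MoratoUgolini2013, AlbeverioVecchiUgolini2015, LiebSeiringer2002, LiebSeiringerSolovejYngvason2005, Junge2026, Four]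

Barriers (technique_class: relative-fisher-info, positive-ground-state, propagation): - technique_class: relative-fisher-info, positive-ground-state, propagation
- Literature.Barriers.AtomisticToContinuum.KineticGapLengthScalesNarrow: its PROVED obstruction
(Galilei boosts: an energy WINDOW valid for all states certifies nothing beyond ρaL²ε ≲ 1) is met by
quantifier order and by mechanism — δ is chosen after N (below the N-body gap), and the transfer
uses the two exits the entry names, (a) the eigenvalue equation beyond the value E₀ (the identity
needs HΨ₀ = E₀Ψ₀) and (b) positivity Ψ₀ > 0 (affinity form of G); rank 3 deliberately sits at the
sub-thermodynamic scale the entry allows (ρaℓ²Y^(1/17) ≲ 1), rank 2 is where the entry bites and is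
filed as the open heart.
- Literature.Barriers.AtomisticToContinuum.KineticGapLengthScales: applies to any proof of rank 2 by
localisation + gap (ceiling a(ρa³)^(-3/4-η)); evaded only insofar as the layer-2 programme replaces
the free gap (2π/L)² by the phonon branch of the trial measure's Witten Laplacian — the bet, no
non-perturbative tool in hand.
- Literature.Barriers.AtomisticToContinuum.EnergyAsymptoticsWithoutCondensationNarrow: the route is
the entry's own exception class — a d = 3-specific inference (IR window Σ_(|k|<√e) k^(-2)|δb̂(k)|²,
summable in d = 3 only) from energy PLUS eigen-equation and positivity, never from the value e₀(ρ)
alone; in the Lieb–Liniger witness the identity still holds but the trial landscape difference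
itself grows like log|x−y|, so nothing false is inferred in d = 1.
- Literature.Barrier

History (route lifecycle, newest last):
- 2026-08-26T03:37:09Z · DORMANT — reconciler: no traction for 8.3 d (last activity item-evidence-added at 2026-08-17T19:20:54Z); parked, not closed — `ledger route dormant route-AtomisticToConti (operator:999:2298358)

sub-problem: BoseEinsteinCondensation · status: dormant · opened planner-plancard-AtomisticToContinuum-BoseEin-821147fd-g2-0 2026-08-15T19:07:23Z · rev 5 · ledger route-AtomisticToContinuum-BECFisherTransfer
GENERATED by the gate from the ledger (D-0016/17). Provers cite these decls: `theorem foo : Summit.AtomisticToContinuum.BoseEinsteinCondensation.Theses.BECFisherTransfer.<Decl> := …` in Summits/AtomisticToContinuum/BoseEinsteinCondensation/Theorems/<Name>.lean.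
-/

namespace Summit.AtomisticToContinuum.BoseEinsteinCondensation.Theses.BECFisherTransfer

open scoped BigOperators Topology Manifold Classical MeasureTheory ProbabilityTheory Matrix InnerProductSpace ComplexConjugate ContinuousMap
open Filter Set Function TopologicalSpace MeasureTheory

attribute [summit_statement] _root_.BoseEinsteinCondensation

/-- item stmt-AtomisticToContinuum-8997 · target · rank 0 · open · by planner
why it might fail: the textbook open problem (LiebSeiringerSolovejYngvason2005 §1.2, Ch. 5 p. 42): no spectral gap at L = (N/ρ)^(1/3); for this route it fails iff CoherencePropagation fails.
sources: LiebSeiringerSolovejYngvason2005, Fournais2020, Junge2026, ChongLiangNam2026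
[target] constant-mode BEC for δ-near-minimisers of the periodic N-body energy on the torus of side
(N/ρ)^{1/3} at all small densities — verbatim the signature of BECPeriodicReduction.PeriodicBEC
(stmt-AtomisticToContinuum-0826); what X buys through ContinuationToPeriodicBEC (or
CoreSubharmonicCoherence through CoreContinuation). -/
@[route_item "route-AtomisticToContinuum-BECFisherTransfer"]
def PeriodicBec : Prop :=
  ∀ v : ℝ → ENNReal, Literature.MathematicalPhysics.QuantumManyBody.BoseGas.IsRepulsiveFiniteRange v → ∃ ρ₀ : ℝ, 0 < ρ₀ ∧ ∀ ρ : ℝ, 0 < ρ → ρ < ρ₀ → ∃ c : ℝ, 0 < c ∧ ∀ᶠ N : ℕ in Filter.atTop, ∃ δ : ENNReal, 0 < δ ∧ ∀ Ψ : Literature.MathematicalPhysics.QuantumManyBody.BoseGas.PeriodicTrialState N (Literature.MathematicalPhysics.QuantumManyBody.BoseGas.sideLength ρ N), Literature.MathematicalPhysics.QuantumManyBody.BoseGas.periodicEnergy v Ψ ≤ Literature.MathematicalPhysics.QuantumManyBody.BoseGas.periodicGroundStateEnergy v N (Literature.MathematicalPhysics.QuantumManyBody.BoseGas.sideLength ρ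 N) + δ → ENNReal.ofReal (c * N) ≤ Literature.MathematicalPhysics.QuantumManyBody.BoseGas.condensateOccupation N (Literature.MathematicalPhysics.QuantumManyBody.BoseGas.sideLength ρ N) Ψ.ψ

/-- item stmt-AtomisticToContinuum-14303 · crux · rank 2 · open · by planner
why it might fail: BEC-strength: a 3-D T=0 quasi-condensate (G ≥ ¾ out to a(ρa³)^(-1/2-σ), but occupation ≥ N/2 parked at momenta 0<|k|≲√e) is excluded by no theorem; energy cannot see it (boosts cost only N/L², KineticGapLengthScalesNarrow); it happens in d=1 (PitaevskiiStringari1991).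
sources: LiebSeiringerSolovejYngvason2005, PitaevskiiStringari1991, ReattoChester1967, Junge2026, Fournais2020, Literature.Barriers.AtomisticToContinuum.KineticGapLengthScalesNarrow
[crux] X_prop (card crux (C) in robust, quantitative dress). For every repulsive finite-range v and
every σ > 0 there is ρ₀ > 0 such that for 0 < ρ < ρ₀, for all large N there is δ > 0 with: every
periodic trial state Ψ on the torus of side L = (N/ρ)^(1/3) with periodicEnergy ≤ E₀^per + δ AND
displacement coherence G_Ψ(i,r) ≥ ¾ for all particles i and all |r| ≤ a(ρa³)^(-1/2-σ) (a =
scattering length) has condensateOccupation ≥ N/2 — near-field coherence at any scale parametrically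
beyond the healing length propagates to the whole torus with at most ¼ further loss, UNIFORMLY in N
(n₀/N = avg_r G; the ½ is not implied by any ∃c statement). Informal mechanism: beyond e^(-1/2) the
mismatch f = Ψ₀/Φ_trial must not be parked in the infrared window |k| < e^(1/2), i.e. log f(·,X̂)
has O(1) mean deviation across the whole cell (layer 2). [deps: HealingScaleCoherence] [difficulty:
open-problem] -/
@[route_item "route-AtomisticToContinuum-BECFisherTransfer", crux]
def CoherencePropagation : Prop :=
  ∀ v : ℝ → ENNReal, Literature.MathematicalPhysics.QuantumManyBody.BoseGas.IsRepulsiveFiniteRange v → ∀ σ : ℝ, 0 < σ → ∃ ρ₀ : ℝ, 0 < ρ₀ ∧ ∀ ρ : ℝ, 0 < ρ → ρ < ρ₀ → ∀ᶠ N : ℕ in Filter.atTop, ∃ δ : ENNReal, 0 < δ ∧ ∀ Ψ : Literature.MathematicalPhysics.QuantumManyBody.BoseGas.PeriodicTrialState N (Literature.MathematicalPhysics.QuantumManyBody.BoseGas.sideLength ρ N), Literature.MathematicalPhysics.QuantumManyBody.BoseGas.periodicEnergy v Ψ ≤ Literature.MathematicalPhysics.QuantumManyBody.BoseGas.periodicGroundStateEnergy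 v N (Literature.MathematicalPhysics.QuantumManyBody.BoseGas.sideLength ρ N) + δ → (∀ (i : Fin N) (r : EuclideanSpace ℝ (Fin 3)), ‖r‖ ≤ (Literature.MathematicalPhysics.QuantumManyBody.BoseGas.scatteringLength v).toReal * (ρ * (Literature.MathematicalPhysics.QuantumManyBody.BoseGas.scatteringLength v).toReal ^ 3) ^ (-(1 : ℝ) / 2 - σ) → (3 / 4 : ℝ) ≤ (∫ X in Literature.MathematicalPhysics.QuantumManyBody.BoseGas.cellN N (Literature.MathematicalPhysics.QuantumManyBody.BoseGas.sideLength ρ N), conj (Ψ.ψ (Function.update X i (X i + r))) * Ψ.ψ X).re) → ENNReal.ofReal ((1 / 2 : ℝ) * N) ≤ Literature.MathematicalPhysics.QuantumManyBody.BoseGas.condensateOccupation N (Literature.MathematicalPhysics.QuantumManyBody.BoseGas.sideLength ρ N) Ψ.ψ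

/-- item stmt-AtomisticToContinuum-14304 · crux · rank 3 · open · by planner
why it might fail: Needs E₀^per < ⊤ and both LSSY bounds at L=(N/ρ)^(1/3) for EVERY admissible v incl. hard cores/hollow shells (ρ₀(v) must beat jamming); σ < 1/34; and beyond ξ a no-clustering bound (o(1) mass in ℓ-cubes holding ≫ ρℓ³ particles, for near-minimisers) from the cell method — unprinted at this scale.
sources: LiebSeiringerSolovejYngvason2005, LiebSeiringer2002, Fournais2020, Junge2026, OttoVillani2000, AlbeverioHoeghkrohnStreit1977
[crux] X_loc (card consequence (A) at the precision of PROVED energy facts). For every repulsive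
finite-range v there are σ > 0 and ρ₀ > 0 such that for 0 < ρ < ρ₀, all large N, some δ > 0 and
every δ-near-minimiser Ψ of the periodic energy on the torus of side (N/ρ)^(1/3): G_Ψ(i,r) ≥ ¾ for
every particle i and every |r| ≤ a(ρa³)^(-1/2-σ) — local coherence of the THERMODYNAMIC object
parametrically beyond the healing length. Two proofs foreseen: (i) the card's:
GroundStateRepresentation + TrialDriftFisherBound (e ≲ ρaY^(1/17)) + a Palm-transport step along r
(Cauchy–Schwarz in the trial bridge measure) + PeriodicRigidity to reach near-minimisers; (ii)
in-class: energy localisation LSSY2005_lemma52_periodic_holds + generalized Poincaré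
LSSY2005_lemma41_periodic_holds on sub-cells of side ℓ = aY^(-1/2-σ) applied to every state in the
window directly (no rigidity, no positivity), which works iff ρaℓ²Y^(1/17) ≪ 1, given an o(1) bound
on the mass of over-crowded ℓ-cubes (excluded volume ≪ ℓ³) from superadditivity / the cell method
(LSSY2005_superadditivity_holds, LSSY2005_cellDecomposition_holds). [difficulty: L] -/
@[route_item "route-AtomisticToContinuum-BECFisherTransfer", crux]
def HealingScaleCoherence : Prop :=
  ∀ v : ℝ → ENNReal, Literature.MathematicalPhysics.QuantumManyBody.BoseGas.IsRepulsiveFiniteRange v → ∃ σ : ℝ, 0 < σ ∧ ∃ ρ₀ : ℝ, 0 < ρ₀ ∧ ∀ ρ : ℝ, 0 < ρ → ρ < ρ₀ → ∀ᶠ N : ℕ in Filter.atTop, ∃ δ : ENNReal, 0 < δ ∧ ∀ Ψ : Literature.MathematicalPhysics.QuantumManyBody.BoseGas.PeriodicTrialState N (Literature.MathematicalPhysics.QuantumManyBody.BoseGas.sideLength ρ N), Literature.MathematicalPhysics.QuantumManyBody.BoseGas.periodicEnergy v Ψ ≤ Literature.MathematicalPhysics.QuantumManyBody.BoseGas.periodicGroundStateEnergy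 v N (Literature.MathematicalPhysics.QuantumManyBody.BoseGas.sideLength ρ N) + δ → ∀ (i : Fin N) (r : EuclideanSpace ℝ (Fin 3)), ‖r‖ ≤ (Literature.MathematicalPhysics.QuantumManyBody.BoseGas.scatteringLength v).toReal * (ρ * (Literature.MathematicalPhysics.QuantumManyBody.BoseGas.scatteringLength v).toReal ^ 3) ^ (-(1 : ℝ) / 2 - σ) → (3 / 4 : ℝ) ≤ (∫ X in Literature.MathematicalPhysics.QuantumManyBody.BoseGas.cellN N (Literature.MathematicalPhysics.QuantumManyBody.BoseGas.sideLength ρ N), conj (Ψ.ψ (Function.update X i (X i + r))) * Ψ.ψ X).re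

/-- item stmt-AtomisticToContinuum-0827 · crux · rank 4 · open · by planner
why it might fail: PeriodicBEC(v) constrains only δ-near-minimisers of the PERIODIC energy (δ after N): the Dirichlet GS lies a wall energy ≫ δ above E₀^per, interior restrictions are neither periodic nor sharp-N, so the hypothesis never fires; only the ENERGY transfer is printed (LSSY Ch. 2 after (2.8)).
sources: LiebSeiringerSolovejYngvason2005, ReedSimonIV1978, Junge2026, PenroseOnsager1956
[crux] BoundaryTransferWeak (mode-free boundary-condition transfer, per potential): for each
repulsive finite-range v, PeriodicBEC(v) implies ∃ρ₀>0 ∀ρ∈(0,ρ₀) HasGroundStateBEC v ρ (Dirichlet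
ground state, λ_max(γ) ≥ cN via condensateNumber). Not glue: near-minimiser slacks are O(N/L²) while
Dirichlet/periodic energies differ by a boundary term ≫ N/L², so no energy-comparison proof;
expected route: Neumann bracketing of interior sub-boxes (−Δ_Dir ≥ ⊕−Δ_Neu, v ≥ 0) + a mode-free
criterion (λ_max ≥ tr γ²/N). Only the ENERGY analogue is in print (LiebSeiringerSolovejYngvason2005
Ch. 2 after (2.8)). v ≡ 0: hypothesis and conclusion both true. -/
@[route_item "route-AtomisticToContinuum-BECFisherTransfer", crux]
def BoundaryTransferWeak : Prop :=
  ∀ v : ℝ → ENNReal, Literature.MathematicalPhysics.QuantumManyBody.BoseGas.IsRepulsiveFiniteRange v → (∃ ρ₀ : ℝ, 0 < ρ₀ ∧ ∀ ρ : ℝ, 0 < ρ → ρ < ρ₀ → ∃ c : ℝ, 0 < c ∧ ∀ᶠ N : ℕ in Filter.atTop, ∃ δ : ENNReal, 0 < δ ∧ ∀ Ψ : Literature.MathematicalPhysics.QuantumManyBody.BoseGas.PeriodicTrialState N (Literature.MathematicalPhysics.QuantumManyBody.BoseGas.sideLength ρ N), Literature.MathematicalPhysics.QuantumManyBody.BoseGas.periodicEnergy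 v Ψ ≤ Literature.MathematicalPhysics.QuantumManyBody.BoseGas.periodicGroundStateEnergy v N (Literature.MathematicalPhysics.QuantumManyBody.BoseGas.sideLength ρ N) + δ → ENNReal.ofReal (c * N) ≤ Literature.MathematicalPhysics.QuantumManyBody.BoseGas.condensateOccupation N (Literature.MathematicalPhysics.QuantumManyBody.BoseGas.sideLength ρ N) Ψ.ψ) → ∃ ρ₀ : ℝ, 0 < ρ₀ ∧ ∀ ρ : ℝ, 0 < ρ → ρ < ρ₀ → Literature.MathematicalPhysics.QuantumManyBody.BoseGas.HasGroundStateBEC v ρ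

/-- item stmt-AtomisticToContinuum-9467 · crux · rank 5 · open · by planner
why it might fail: Bounded v: known (RS-IV XIII.47 + compact resolvent ⇒ simple GS + gap at fixed N). ⊤-valued v (hard cores, hollow shells ⊤·1_[r₁,r₂]) disconnect the finite-energy configuration space, XIII.48(b) allows degeneracy: the dilute component must be uniquely minimal and connected for all N; unprinted.
sources: ReedSimonIV1978, BaryshnikovBubenikKahle2013, LiebSeiringerSolovejYngvason2005, Fournais2020
[crux] PERIODIC RIGIDITY (torus ground-state rigidity; weakened η-first form, re-filed as a LISTED
item of route BECRieszShadow because the identical ∀ᶠN-first statement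
stmt-AtomisticToContinuum-6516 was closed moot with the retired routes): for every admissible v, ρ <
ρ₀(v), every η > 0, eventually in N, there is δ > 0 such that any two δ-near-minimisers Ψ, Φ of the
periodic energy (L = (N/ρ)^(1/3)) satisfy ∫_(cell^N)|Ψ − cΦ|² ≤ η for some unit complex c (E₀^per <
∞, compact resolvent, unique positive ground state and a spectral gap at fixed N; hard cores via
low-density connectivity of the torus hard-sphere configuration space). This is exactly what
AffinityFrameGlue consumes (η := e^(−C)/4 is fixed before N). Why it might fail: v = ⊤ walls (hard
cores, hollow impenetrable shells ⊤·1_[r₁,r₂]) disconnect the fixed-N configuration space;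
uniqueness then needs every non-dilute component (jammed or bound clusters) to lie an N-uniform gap
above E₀^per, and E₀^per = ⊤ would make the item vacuous-false. Sources: ReedSimonIV1978
XIII.12/XIII.47; BaryshnikovBubenikKahle2013 = doi:10.1093/imrn/rnt012; LSSY2005 Ch. 2; Fournais2020
(1.1)–(1.2). [difficulty: M] -/
@[route_item "route-AtomisticToContinuum-BECFisherTransfer"]
def PeriodicRigidity : Prop :=
  ∀ v : ℝ → ENNReal, Literature.MathematicalPhysics.QuantumManyBody.BoseGas.IsRepulsiveFiniteRange v → ∃ ρ₀ : ℝ, 0 < ρ₀ ∧ ∀ ρ : ℝ, 0 < ρ → ρ < ρ₀ → ∀ η : ℝ, 0 < η → ∀ᶠ N : ℕ in Filter.atTop, ∃ δ : ENNReal, 0 < δ ∧ ∀ Ψ Φ : Literature.MathematicalPhysics.QuantumManyBody.BoseGas.PeriodicTrialState N (Literature.MathematicalPhysics.QuantumManyBody.BoseGas.sideLength ρ N), Literature.MathematicalPhysics.QuantumManyBody.BoseGas.periodicEnergy v Ψ ≤ Literature.MathematicalPhysics.QuantumManyBody.BoseGas.periodicGroundStateEnergy v N (Literature.MathematicalPhysics.QuantumManyBody.BoseGas.sideLength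 ρ N) + δ → Literature.MathematicalPhysics.QuantumManyBody.BoseGas.periodicEnergy v Φ ≤ Literature.MathematicalPhysics.QuantumManyBody.BoseGas.periodicGroundStateEnergy v N (Literature.MathematicalPhysics.QuantumManyBody.BoseGas.sideLength ρ N) + δ → ∃ c : ℂ, ‖c‖ = 1 ∧ ∫⁻ X in Literature.MathematicalPhysics.QuantumManyBody.BoseGas.cellN N (Literature.MathematicalPhysics.QuantumManyBody.BoseGas.sideLength ρ N), (‖Ψ.ψ X - c * Φ.ψ X‖₊ : ENNReal) ^ 2 ≤ ENNReal.ofReal η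

/-- item stmt-AtomisticToContinuum-14101 · support · rank 9 · closed · proved by Summit.AtomisticToContinuum.BoseEinsteinCondensation.Theorems.periodicBecOfCoherence_proof (prover) · by planner
[support] GLUE to the target (route-choice repair 2026-08-16, option (a): `Crux… → PeriodicBec`):
the two length-axis halves X_loc = HealingScaleCoherence (rank 3) and X_prop = CoherencePropagation
(rank 2) give the shared target PeriodicBec (stmt-AtomisticToContinuum-8997) with the explicit
constant c = 1/2. Pure logic, no analysis: fix v; HealingScaleCoherence gives σ > 0 and ρ₂ with an
eventual-in-N slack δ₂; CoherencePropagation at that σ gives ρ₁ and an eventual δ₁; for ρ < min ρ₁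
ρ₂ take c := 1/2 and, eventually in N, δ := min δ₁ δ₂ — every δ-near-minimiser satisfies the
¾-coherence hypothesis (δ ≤ δ₂) hence has condensateOccupation ≥ N/2 (δ ≤ δ₁), which is the
PeriodicBec clause. This is the bookkeeping already certified inside `closes`, stopped one step
earlier so that the target is concluded BY NAME; checked sorry-free in the planner's Sketch.lean
(lean check rc 0). With it, PeriodicBec → (BoundaryTransferWeak) → BoseEinsteinCondensation is two
lines. [difficulty: provable-now] Sources: LiebSeiringerSolovejYngvason2005 (Ch. 2, periodic vs
Dirichlet BEC), PenroseOnsager1956. -/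
@[route_item "route-AtomisticToContinuum-BECFisherTransfer"]
def PeriodicBecOfCoherence : Prop :=
  HealingScaleCoherence → CoherencePropagation → PeriodicBec

-- `PeriodicBecOfCoherence` holds: proved by `Summit.AtomisticToContinuum.BoseEinsteinCondensation.Theorems.periodicBecOfCoherence_proof` (its module imports this route file, so no `_holds` link can be stated here).

/-- item stmt-AtomisticToContinuum-14305 · support · rank 9 · closed · proved by Summit.AtomisticToContinuum.BoseEinsteinCondensation.Theorems.groundStateRepresentation_proof (prover) · by planner
sources: LiebSeiringerSolovejYngvason2005, AlbeverioHoeghkrohnStreit1977, RezakhanlouVillani2008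
[support] the namesake identity, periodic form, over the landed definition relativeFisherInformation
(Literature/MathematicalPhysics/QuantumManyBody/RelativeFisherInformation.lean): for any v, N, L, an
exact real positive C¹ minimiser Ψ₀ of the periodic energy and any real periodic trial state Φ,
periodicEnergy v Φ = E₀^per + ¼ I_(cell^N)(P_Φ‖P_Ψ₀) = E₀^per + ∫_(cell^N) |∇(Φ/Ψ₀)|² Ψ₀². Proof
without integration by parts: first variation of the constrained minimum in the symmetric C¹
direction (Φ/Ψ₀)²Ψ₀ (V ∈ L¹(cell^N) because Ψ₀ ≥ min Ψ₀ > 0 on the compact torus and E(Ψ₀) < ⊤),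
then the Jacobi identity |∇(hΨ₀)|² = |∇h|²Ψ₀² + ∇Ψ₀·∇(h²Ψ₀); E₀^per = ⊤ and L ≤ 0 are trivially
covered (⊤ + x = ⊤; no states). Vacuous for hard cores (no positive C¹ minimiser), as intended.
[difficulty: provable-now] -/
@[route_item "route-AtomisticToContinuum-BECFisherTransfer"]
def GroundStateRepresentation : Prop :=
  open Literature.MathematicalPhysics.QuantumManyBody.BoseGas in ∀ (v : ℝ → ENNReal) (N : ℕ) (L : ℝ) (Ψ₀ Φ : PeriodicTrialState N L), periodicEnergy v Ψ₀ = periodicGroundStateEnergy v N L → (∀ X, Ψ₀.ψ X = ((Ψ₀.ψ X).re : ℂ) ∧ 0 < (Ψ₀.ψ X).re) → (∀ X, Φ.ψ X = ((Φ.ψ X).re : ℂ)) → periodicEnergy v Φ = periodicGroundStateEnergy v N L + 4⁻¹ * relativeFisherInformation (cellN N L) (fun X => (Φ.ψ X).re) (fun X => (Ψ₀.ψ X).re)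

-- `GroundStateRepresentation` holds: proved by `Summit.AtomisticToContinuum.BoseEinsteinCondensation.Theorems.groundStateRepresentation_proof` (its module imports this route file, so no `_holds` link can be stated here).

/-- item stmt-AtomisticToContinuum-14306 · support · rank 9 · closed · proved by Summit.AtomisticToContinuum.BoseEinsteinCondensation.Theorems.TrialDriftFisher.trialDriftFisherBound_proof (prover) · by planner
sources: LiebSeiringerSolovejYngvason2005, Dyson1957, OttoVillani2000
[support] the mechanism's quantitative input, from PROVED cone facts only: for every admissible v
there are ρ₀, C such that for ρ < ρ₀, eventually in N, for every exact real positive periodic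
minimiser Ψ₀ there is a normalised periodic trial state Φ of Bijl–Dyson–Jastrow form Φ = c·Π_(i<j)
φ^per(x_i − x_j) (IsPairProfile b φ, jastrow of PeriodicBoseGasJastrow.lean) with relative Fisher
information I_(cell^N)(P_Φ‖P_Ψ₀) ≤ C·ρa·Y^(1/17)·N, Y = 4πρa³/3, a = scattering length — i.e. the
conditional one-body drift of the LSSY trial state is within O((ρaY^(1/17))^(1/2)) of the true drift
in L²(P_Φ), per particle. Proof: GroundStateRepresentation (I = 4(E(Φ) − E₀^per)) + the Dyson
profile at b = ρ^(-1/3) (LSSY2005_dysonProfile_holds, LSSY2005_jastrowBound_holds: E(Φ)/N ≤ 4πρa(1 +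
C(Y^(1/3) + Y^(1/17)))) + LSSY2005_lowerBound_periodic_holds (E₀^per/N ≥ 4πρa(1 − CY^(1/17))); a ≤
R₀ < ⊤ by scatteringLength_le_range; a = 0 ⇒ v = 0 a.e. (LSSY2005_zeroScatteringLength_holds), Ψ₀ =
const, φ ≡ 1. [difficulty: M] -/
@[route_item "route-AtomisticToContinuum-BECFisherTransfer"]
def TrialDriftFisherBound : Prop :=
  open Literature.MathematicalPhysics.QuantumManyBody.BoseGas in ∀ v : ℝ → ENNReal, IsRepulsiveFiniteRange v → ∃ ρ₀ : ℝ, 0 < ρ₀ ∧ ∃ C : ℝ, ∀ ρ : ℝ, 0 < ρ → ρ < ρ₀ → ∀ᶠ N : ℕ in Filter.atTop, ∀ Ψ₀ : PeriodicTrialState N (sideLength ρ N), periodicEnergy v Ψ₀ = periodicGroundStateEnergy v N (sideLength ρ N) → (∀ X, Ψ₀.ψ X = ((Ψ₀.ψ X).re : ℂ) ∧ 0 < (Ψ₀.ψ X).re) → ∃ (Φ : PeriodicTrialState N (sideLength ρ N)) (b c : ℝ) (φ : Space → ℝ), IsPairProfile b φ ∧ 0 < c ∧ (∀ X, Φ.ψ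 X = ((c * jastrow (sideLength ρ N) φ Finset.univ X : ℝ) : ℂ)) ∧ relativeFisherInformation (cellN N (sideLength ρ N)) (fun X => (Φ.ψ X).re) (fun X => (Ψ₀.ψ X).re) ≤ ENNReal.ofReal (C * ρ * (scatteringLength v).toReal * (4 * Real.pi * ρ * (scatteringLength v).toReal ^ 3 / 3) ^ ((1 : ℝ) / 17) * N)

-- `TrialDriftFisherBound` holds: proved by `Summit.AtomisticToContinuum.BoseEinsteinCondensation.Theorems.TrialDriftFisher.trialDriftFisherBound_proof` (its module imports this route file, so no `_holds` link can be stated here).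

/-- item stmt-AtomisticToContinuum-9164 · support · rank 9 · closed · proved by Summit.AtomisticToContinuum.BoseEinsteinCondensation.Theorems.periodicOccupationStability_proof (prover) · by planner
sources: LiebSeiringerSolovejYngvason2005, Fournais2020
[support] OCCUPATION STABILITY on the torus: for periodic trial states Ψ, Φ of N bosons and |c| = 1,
condensateOccupation(Ψ)^(1/2) ≤ condensateOccupation(Φ)^(1/2) + N^(1/2) (∫_(cell^N)|Ψ − cΦ|²)^(1/2)
(F_Ψ(Y) = ⟨φ₀, Ψ(·,Y)1_cell⟩, |F_Ψ − F_(cΦ)| ≤ ‖(Ψ − cΦ)(·,Y)‖_(L²(cell)), Minkowski in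
L²(cell^(N−1)); occ(cΦ) = occ(Φ)). [difficulty: provable-now] -/
@[route_item "route-AtomisticToContinuum-BECFisherTransfer"]
def PeriodicOccupationStability : Prop :=
  ∀ (N : ℕ) (L : ℝ), 0 < L → ∀ (Ψ Φ : Literature.MathematicalPhysics.QuantumManyBody.BoseGas.PeriodicTrialState N L) (c : ℂ), ‖c‖ = 1 → Literature.MathematicalPhysics.QuantumManyBody.BoseGas.condensateOccupation N L Ψ.ψ ^ (1 / 2 : ℝ) ≤ Literature.MathematicalPhysics.QuantumManyBody.BoseGas.condensateOccupation N L Φ.ψ ^ (1 / 2 : ℝ) + (N : ENNReal) ^ (1 / 2 : ℝ) * (∫⁻ X in Literature.MathematicalPhysics.QuantumManyBody.BoseGas.cellN N L, (‖Ψ.ψ X - c * Φ.ψ X‖₊ : ENNReal) ^ 2) ^ (1 / 2 : ℝ)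

-- `PeriodicOccupationStability` holds: proved by `Summit.AtomisticToContinuum.BoseEinsteinCondensation.Theorems.periodicOccupationStability_proof` (its module imports this route file, so no `_holds` link can be stated here).

/-- item stmt-AtomisticToContinuum-14307 · assembly · rank 1 · closed · proved by Summit.AtomisticToContinuum.BoseEinsteinCondensation.Theorems.becFisherTransfer_assembly_proof (prover) · by planner
sources: LiebSeiringerSolovejYngvason2005, PenroseOnsager1956
[assembly] HealingScaleCoherence → CoherencePropagation → BoundaryTransferWeak →
BoseEinsteinCondensation (the deciding theorem `closes` has exactly these three hypotheses). -/
@[route_item "route-AtomisticToContinuum-BECFisherTransfer"]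
def Assembly : Prop :=
  HealingScaleCoherence → CoherencePropagation → BoundaryTransferWeak → BoseEinsteinCondensation

-- `Assembly` holds: proved by `Summit.AtomisticToContinuum.BoseEinsteinCondensation.Theorems.becFisherTransfer_assembly_proof` (its module imports this route file, so no `_holds` link can be stated here).

/-! D-0027 §2.1 — DECIDING THEOREM (planner-authored via `route open/edit --closes-file`; by planner-rrepair-AtomisticToContinuum-BECFisher-8d08035d-0 2026-08-15T20:15:05Z):
its hypotheses are this route's items and its conclusion the sub-problem Statement (glue_lint), and it elaborates with this file. -/

@[closes "route-AtomisticToContinuum-BECFisherTransfer"] theorem closes (hLoc : HealingScaleCoherence) (hProp : CoherencePropagation) (hBC : BoundaryTransferWeak) :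
    _root_.BoseEinsteinCondensation := by
  intro v hv
  refine hBC v hv ?_
  obtain ⟨σ, hσ, ρ₂, hρ₂, hA'⟩ := hLoc v hv
  obtain ⟨ρ₁, hρ₁, hP'⟩ := hProp v hv σ hσ
  refine ⟨min ρ₁ ρ₂, lt_min hρ₁ hρ₂, fun ρ hρ hρlt => ?_⟩
  have h₁ := hP' ρ hρ (lt_of_lt_of_le hρlt (min_le_left _ _))
  have h₂ := hA' ρ hρ (lt_of_lt_of_le hρlt (min_le_right _ _))
  refine ⟨1 / 2, by norm_num, ?_⟩
  filter_upwards [h₁, h₂] with N hN₁ hN₂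
  obtain ⟨δ₁, hδ₁, H₁⟩ := hN₁
  obtain ⟨δ₂, hδ₂, H₂⟩ := hN₂
  refine ⟨min δ₁ δ₂, lt_min hδ₁ hδ₂, fun Ψ hΨ => ?_⟩
  exact H₁ Ψ (hΨ.trans <| by gcongr; exact min_le_left _ _)
    (H₂ Ψ (hΨ.trans <| by gcongr; exact min_le_right _ _))

end Summit.AtomisticToContinuum.BoseEinsteinCondensation.Theses.BECFisherTransfer
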